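import Mathlib

/-!
# PneNP / OverlapGapAlgebra — crux `SolvableImpliesStableSection` (stmt-PneNP-2463):
# the TWO-WAY REPAIR block (5/·) — the repair dynamics: nominees, flips, recency

Support for crux `stmt-PneNP-2463` (`Summit.PneNP.PneNP.Theses.OverlapGapAlgebra.SolvableImpliesStableSection`):
the f-free block "bounded-round two-way repair with one-round memory gives stable sections for every
`ν > 0` up to `α ≤ 2^k/(4k)`".  TWO-WAY REPAIR on an instance `Φ : Fin m → Fin k → Fin n × Bool`: all
variables start `true`; at every round EVERY violated clause flips the variable of ONE of its slots —
its NOMINEE, the least slot in the priority order (class `0`: negative slot whose variable did not flip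
at the last round; class `1`: positive slot whose variable did not flip at the last round; class `2`:
the variable flipped at the last round), all clauses simultaneously (a variable nominated by several
clauses flips once).  The values are an opaque `val : ℕ → instances → Fin n → Bool` specified by
`hval0` (round `0`: all `true`) and `hvalW` (`val (t+1) Φ v = val t Φ v` iff `v` is not nominated by a
clause violated at round `t`).  Consequences:

* `sissW_key_eq_two/one/zero` — the three priority classes; `sissW_nom_exists`, `sissW_nom_unique`,
  `sissW_nom_lt` — every clause has a unique nominee, and the slots before it have higher class;
* `sissW_flip_ne`, `sissW_noflip_eq` — a nominated variable changes, the others do not;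
* `sissW_not_viol_succ` — a violated clause is satisfied at the next round (no dead clauses);
* `sissW_newly_violated` — hence a clause violated at round `t + 1` has a slot whose variable flipped
  at round `t` (recency); `sissW_rec_flip` — a variable that changed was nominated;
* `sissW_exists_flip_false` — a `false` variable was flipped from `true` to `false` by a nomination at
  an earlier round.
No definitions (all objects are hypotheses); axioms `propext`, `Classical.choice`, `Quot.sound`.
-/

set_option linter.dupNamespace false -- `Summit.PneNP.PneNP.…`: summit = sub-problem (D-0017)

namespace Summit.PneNP.PneNP.Theorems

open Finset
open scoped Classical

section Dynamics

variable {m k n : ℕ}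

/-- Class `2`: the variable of the slot flipped at the last round. -/
theorem sissW_key_eq_two (val : ℕ → (Fin m → Fin k → Fin n × Bool) → Fin n → Bool) (t : ℕ) (Φ : (Fin m → Fin k → Fin n × Bool)) (i : Fin m) (j : Fin k) :
    (if 1 ≤ t ∧ val t Φ (Φ i j).1 ≠ val (t - 1) Φ (Φ i j).1 then (2 : ℕ)
          else if (Φ i j).2 = true then 1 else 0) = 2 ↔ (1 ≤ t ∧ val t Φ (Φ i j).1 ≠ val (t - 1) Φ (Φ i j).1) := by
  by_cases h : (1 ≤ t ∧ val t Φ (Φ i j).1 ≠ val (t - 1) Φ (Φ i j).1)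
  · rw [if_pos h]; exact ⟨fun _ => h, fun _ => rfl⟩
  · rw [if_neg h]
    constructor
    · intro h'; exfalso; (split_ifs at h'; norm_num at h')
    · intro h'; exact absurd h' h

/-- Class `1`: a positive slot whose variable did not flip at the last round. -/
theorem sissW_key_eq_one (val : ℕ → (Fin m → Fin k → Fin n × Bool) → Fin n → Bool) (t : ℕ) (Φ : (Fin m → Fin k → Fin n × Bool)) (i : Fin m) (j : Fin k) :
    (if 1 ≤ t ∧ val t Φ (Φ i j).1 ≠ val (t - 1) Φ (Φ i j).1 then (2 : ℕ)
          else if (Φ i j).2 = true then 1 else 0) = 1 ↔ (¬ (1 ≤ t ∧ val t Φ (Φ i j).1 ≠ val (t - 1) Φ (Φ i j).1) ∧ (Φ i j).2 = true) := by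
  by_cases h : (1 ≤ t ∧ val t Φ (Φ i j).1 ≠ val (t - 1) Φ (Φ i j).1)
  · rw [if_pos h]
    constructor
    · intro h'; exact absurd h' (by norm_num)
    · intro h'; exact absurd h h'.1
  · rw [if_neg h]
    by_cases hs : (Φ i j).2 = true
    · rw [if_pos hs]; exact ⟨fun _ => ⟨h, hs⟩, fun _ => rfl⟩
    · rw [if_neg hs]
      constructor
      · intro h'; exact absurd h' (by norm_num)
      · intro h'; exact absurd h'.2 hs

/-- Class `0`: a negative slot whose variable did not flip at the last round. -/
theorem sissW_key_eq_zero (val : ℕ → (Fin m → Fin k → Fin n × Bool) → Fin n → Bool) (t : ℕ) (Φ : (Fin m → Fin k → Fin n × Bool)) (i : Fin m) (j : Fin k) :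
    (if 1 ≤ t ∧ val t Φ (Φ i j).1 ≠ val (t - 1) Φ (Φ i j).1 then (2 : ℕ)
          else if (Φ i j).2 = true then 1 else 0) = 0 ↔ (¬ (1 ≤ t ∧ val t Φ (Φ i j).1 ≠ val (t - 1) Φ (Φ i j).1) ∧ (Φ i j).2 = false) := by
  by_cases h : (1 ≤ t ∧ val t Φ (Φ i j).1 ≠ val (t - 1) Φ (Φ i j).1)
  · rw [if_pos h]
    constructor
    · intro h'; exact absurd h' (by norm_num)
    · intro h'; exact absurd h h'.1
  · rw [if_neg h]
    by_cases hs : (Φ i j).2 = true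
    · rw [if_pos hs]
      constructor
      · intro h'; exact absurd h' (by norm_num)
      · intro h'; rw [hs] at h'; exact absurd h'.2 (by simp)
    · rw [if_neg hs]
      exact ⟨fun _ => ⟨h, by simpa using hs⟩, fun _ => rfl⟩

/-- The class of a slot is at most `2`. -/
theorem sissW_key_le_two (val : ℕ → (Fin m → Fin k → Fin n × Bool) → Fin n → Bool) (t : ℕ) (Φ : (Fin m → Fin k → Fin n × Bool)) (i : Fin m) (j : Fin k) :
    (if 1 ≤ t ∧ val t Φ (Φ i j).1 ≠ val (t - 1) Φ (Φ i j).1 then (2 : ℕ)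
          else if (Φ i j).2 = true then 1 else 0) ≤ 2 := by
  split_ifs <;> norm_num

/-- **Every clause has a nominee** (`k ≥ 1`): a slot of least class, least among those. -/
theorem sissW_nom_exists (val : ℕ → (Fin m → Fin k → Fin n × Bool) → Fin n → Bool) (t : ℕ) (Φ : (Fin m → Fin k → Fin n × Bool)) (i : Fin m)
    (hk : 1 ≤ k) : ∃ jf : Fin k, (∀ j' : Fin k, (if 1 ≤ t ∧ val t Φ (Φ i jf).1 ≠ val (t - 1) Φ (Φ i jf).1 then (2 : ℕ)
          else if (Φ i jf).2 = true then 1 else 0) < (if 1 ≤ t ∧ val t Φ (Φ i j').1 ≠ val (t - 1) Φ (Φ i j').1 then (2 : ℕ)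
          else if (Φ i j').2 = true then 1 else 0) ∨
        ((if 1 ≤ t ∧ val t Φ (Φ i jf).1 ≠ val (t - 1) Φ (Φ i jf).1 then (2 : ℕ)
          else if (Φ i jf).2 = true then 1 else 0) = (if 1 ≤ t ∧ val t Φ (Φ i j').1 ≠ val (t - 1) Φ (Φ i j').1 then (2 : ℕ)
          else if (Φ i j').2 = true then 1 else 0) ∧ jf ≤ j')) := by
  -- the slots of least class
  obtain ⟨j₀, _, hj₀⟩ := Finset.exists_min_image (univ : Finset (Fin k))
    (fun j => (if 1 ≤ t ∧ val t Φ (Φ i j).1 ≠ val (t - 1) Φ (Φ i j).1 then (2 : ℕ)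
          else if (Φ i j).2 = true then 1 else 0)) ⟨⟨0, hk⟩, mem_univ _⟩
  set C := (univ : Finset (Fin k)).filter fun j =>
    ∀ j' : Fin k, (if 1 ≤ t ∧ val t Φ (Φ i j).1 ≠ val (t - 1) Φ (Φ i j).1 then (2 : ℕ)
          else if (Φ i j).2 = true then 1 else 0) ≤ (if 1 ≤ t ∧ val t Φ (Φ i j').1 ≠ val (t - 1) Φ (Φ i j').1 then (2 : ℕ)
          else if (Φ i j').2 = true then 1 else 0) with hC
  have hne : C.Nonempty := ⟨j₀, by
    rw [hC, Finset.mem_filter]; exact ⟨mem_univ _, fun j' => hj₀ j' (mem_univ _)⟩⟩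
  refine ⟨C.min' hne, fun j' => ?_⟩
  have hmin : ∀ j'' : Fin k, (if 1 ≤ t ∧ val t Φ (Φ i (C.min' hne)).1 ≠ val (t - 1) Φ (Φ i (C.min' hne)).1 then (2 : ℕ)
          else if (Φ i (C.min' hne)).2 = true then 1 else 0) ≤ (if 1 ≤ t ∧ val t Φ (Φ i j'').1 ≠ val (t - 1) Φ (Φ i j'').1 then (2 : ℕ)
          else if (Φ i j'').2 = true then 1 else 0) :=
    (Finset.mem_filter.1 (C.min'_mem hne)).2
  rcases Nat.lt_or_ge ((if 1 ≤ t ∧ val t Φ (Φ i (C.min' hne)).1 ≠ val (t - 1) Φ (Φ i (C.min' hne)).1 then (2 : ℕ)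
          else if (Φ i (C.min' hne)).2 = true then 1 else 0)) ((if 1 ≤ t ∧ val t Φ (Φ i j').1 ≠ val (t - 1) Φ (Φ i j').1 then (2 : ℕ)
          else if (Φ i j').2 = true then 1 else 0)) with hlt | hge
  · exact Or.inl hlt
  · right
    have heq : (if 1 ≤ t ∧ val t Φ (Φ i (C.min' hne)).1 ≠ val (t - 1) Φ (Φ i (C.min' hne)).1 then (2 : ℕ)
          else if (Φ i (C.min' hne)).2 = true then 1 else 0) = (if 1 ≤ t ∧ val t Φ (Φ i j').1 ≠ val (t - 1) Φ (Φ i j').1 then (2 : ℕ)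
          else if (Φ i j').2 = true then 1 else 0) := le_antisymm (hmin j') hge
    refine ⟨heq, Finset.min'_le C j' ?_⟩
    rw [hC, Finset.mem_filter]
    exact ⟨mem_univ _, fun j'' => heq ▸ hmin j''⟩

/-- **The nominee is unique.** -/
theorem sissW_nom_unique (val : ℕ → (Fin m → Fin k → Fin n × Bool) → Fin n → Bool) (t : ℕ) (Φ : (Fin m → Fin k → Fin n × Bool)) (i : Fin m)
    (jf₁ jf₂ : Fin k) (h₁ : (∀ j' : Fin k, (if 1 ≤ t ∧ val t Φ (Φ i jf₁).1 ≠ val (t - 1) Φ (Φ i jf₁).1 then (2 : ℕ)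
          else if (Φ i jf₁).2 = true then 1 else 0) < (if 1 ≤ t ∧ val t Φ (Φ i j').1 ≠ val (t - 1) Φ (Φ i j').1 then (2 : ℕ)
          else if (Φ i j').2 = true then 1 else 0) ∨
        ((if 1 ≤ t ∧ val t Φ (Φ i jf₁).1 ≠ val (t - 1) Φ (Φ i jf₁).1 then (2 : ℕ)
          else if (Φ i jf₁).2 = true then 1 else 0) = (if 1 ≤ t ∧ val t Φ (Φ i j').1 ≠ val (t - 1) Φ (Φ i j').1 then (2 : ℕ)
          else if (Φ i j').2 = true then 1 else 0) ∧ jf₁ ≤ j'))) (h₂ : (∀ j' : Fin k, (if 1 ≤ t ∧ val t Φ (Φ i jf₂).1 ≠ val (t - 1) Φ (Φ i jf₂).1 then (2 : ℕ)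
          else if (Φ i jf₂).2 = true then 1 else 0) < (if 1 ≤ t ∧ val t Φ (Φ i j').1 ≠ val (t - 1) Φ (Φ i j').1 then (2 : ℕ)
          else if (Φ i j').2 = true then 1 else 0) ∨
        ((if 1 ≤ t ∧ val t Φ (Φ i jf₂).1 ≠ val (t - 1) Φ (Φ i jf₂).1 then (2 : ℕ)
          else if (Φ i jf₂).2 = true then 1 else 0) = (if 1 ≤ t ∧ val t Φ (Φ i j').1 ≠ val (t - 1) Φ (Φ i j').1 then (2 : ℕ)
          else if (Φ i j').2 = true then 1 else 0) ∧ jf₂ ≤ j'))) : jf₁ = jf₂ := by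
  rcases h₁ jf₂ with hlt | ⟨heq₁, hle⟩
  · rcases h₂ jf₁ with hlt' | ⟨heq₂, _⟩
    · exact absurd (hlt.trans hlt') (lt_irrefl _)
    · omega
  · rcases h₂ jf₁ with hlt' | ⟨_, hle'⟩
    · omega
    · exact le_antisymm hle hle'

/-- **Slots before the nominee have strictly higher class** (in particular class `≥ 1`). -/
theorem sissW_nom_lt (val : ℕ → (Fin m → Fin k → Fin n × Bool) → Fin n → Bool) (t : ℕ) (Φ : (Fin m → Fin k → Fin n × Bool)) (i : Fin m)
    (jf : Fin k) (h : (∀ j' : Fin k, (if 1 ≤ t ∧ val t Φ (Φ i jf).1 ≠ val (t - 1) Φ (Φ i jf).1 then (2 : ℕ)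
          else if (Φ i jf).2 = true then 1 else 0) < (if 1 ≤ t ∧ val t Φ (Φ i j').1 ≠ val (t - 1) Φ (Φ i j').1 then (2 : ℕ)
          else if (Φ i j').2 = true then 1 else 0) ∨
        ((if 1 ≤ t ∧ val t Φ (Φ i jf).1 ≠ val (t - 1) Φ (Φ i jf).1 then (2 : ℕ)
          else if (Φ i jf).2 = true then 1 else 0) = (if 1 ≤ t ∧ val t Φ (Φ i j').1 ≠ val (t - 1) Φ (Φ i j').1 then (2 : ℕ)
          else if (Φ i j').2 = true then 1 else 0) ∧ jf ≤ j'))) (j' : Fin k) (hj' : j' < jf) :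
    (if 1 ≤ t ∧ val t Φ (Φ i jf).1 ≠ val (t - 1) Φ (Φ i jf).1 then (2 : ℕ)
          else if (Φ i jf).2 = true then 1 else 0) < (if 1 ≤ t ∧ val t Φ (Φ i j').1 ≠ val (t - 1) Φ (Φ i j').1 then (2 : ℕ)
          else if (Φ i j').2 = true then 1 else 0) := by
  rcases h j' with hlt | ⟨_, hle⟩
  · exact hlt
  · exact absurd hj' (not_lt.2 hle)

/-- **Every slot has class at least the nominee's.** -/
theorem sissW_nom_le (val : ℕ → (Fin m → Fin k → Fin n × Bool) → Fin n → Bool) (t : ℕ) (Φ : (Fin m → Fin k → Fin n × Bool)) (i : Fin m)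
    (jf : Fin k) (h : (∀ j' : Fin k, (if 1 ≤ t ∧ val t Φ (Φ i jf).1 ≠ val (t - 1) Φ (Φ i jf).1 then (2 : ℕ)
          else if (Φ i jf).2 = true then 1 else 0) < (if 1 ≤ t ∧ val t Φ (Φ i j').1 ≠ val (t - 1) Φ (Φ i j').1 then (2 : ℕ)
          else if (Φ i j').2 = true then 1 else 0) ∨
        ((if 1 ≤ t ∧ val t Φ (Φ i jf).1 ≠ val (t - 1) Φ (Φ i jf).1 then (2 : ℕ)
          else if (Φ i jf).2 = true then 1 else 0) = (if 1 ≤ t ∧ val t Φ (Φ i j').1 ≠ val (t - 1) Φ (Φ i j').1 then (2 : ℕ)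
          else if (Φ i j').2 = true then 1 else 0) ∧ jf ≤ j'))) (j' : Fin k) :
    (if 1 ≤ t ∧ val t Φ (Φ i jf).1 ≠ val (t - 1) Φ (Φ i jf).1 then (2 : ℕ)
          else if (Φ i jf).2 = true then 1 else 0) ≤ (if 1 ≤ t ∧ val t Φ (Φ i j').1 ≠ val (t - 1) Φ (Φ i j').1 then (2 : ℕ)
          else if (Φ i j').2 = true then 1 else 0) := by
  rcases h j' with hlt | ⟨heq, _⟩
  · exact hlt.le
  · exact heq.le

/-- **A nominated variable changes**: `val (t+1) Φ v = ! val t Φ v`. -/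
theorem sissW_flip_ne (val : ℕ → (Fin m → Fin k → Fin n × Bool) → Fin n → Bool)
    (hvalW : ∀ (t : ℕ) (Φ : (Fin m → Fin k → Fin n × Bool)) (v : Fin n), val (t + 1) Φ v = val t Φ v ↔
      ¬ (∃ ii : Fin m, (∀ jj : Fin k, val t Φ (Φ ii jj).1 ≠ (Φ ii jj).2) ∧
        ∃ jf : Fin k, (∀ j' : Fin k, (if 1 ≤ t ∧ val t Φ (Φ ii jf).1 ≠ val (t - 1) Φ (Φ ii jf).1 then (2 : ℕ)
          else if (Φ ii jf).2 = true then 1 else 0) < (if 1 ≤ t ∧ val t Φ (Φ ii j').1 ≠ val (t - 1) Φ (Φ ii j').1 then (2 : ℕ)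
          else if (Φ ii j').2 = true then 1 else 0) ∨
        ((if 1 ≤ t ∧ val t Φ (Φ ii jf).1 ≠ val (t - 1) Φ (Φ ii jf).1 then (2 : ℕ)
          else if (Φ ii jf).2 = true then 1 else 0) = (if 1 ≤ t ∧ val t Φ (Φ ii j').1 ≠ val (t - 1) Φ (Φ ii j').1 then (2 : ℕ)
          else if (Φ ii j').2 = true then 1 else 0) ∧ jf ≤ j')) ∧ (Φ ii jf).1 = v))
    (t : ℕ) (Φ : (Fin m → Fin k → Fin n × Bool)) (v : Fin n) (hfl : (∃ ii : Fin m, (∀ jj : Fin k, val t Φ (Φ ii jj).1 ≠ (Φ ii jj).2) ∧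
        ∃ jf : Fin k, (∀ j' : Fin k, (if 1 ≤ t ∧ val t Φ (Φ ii jf).1 ≠ val (t - 1) Φ (Φ ii jf).1 then (2 : ℕ)
          else if (Φ ii jf).2 = true then 1 else 0) < (if 1 ≤ t ∧ val t Φ (Φ ii j').1 ≠ val (t - 1) Φ (Φ ii j').1 then (2 : ℕ)
          else if (Φ ii j').2 = true then 1 else 0) ∨
        ((if 1 ≤ t ∧ val t Φ (Φ ii jf).1 ≠ val (t - 1) Φ (Φ ii jf).1 then (2 : ℕ)
          else if (Φ ii jf).2 = true then 1 else 0) = (if 1 ≤ t ∧ val t Φ (Φ ii j').1 ≠ val (t - 1) Φ (Φ ii j').1 then (2 : ℕ)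
          else if (Φ ii j').2 = true then 1 else 0) ∧ jf ≤ j')) ∧ (Φ ii jf).1 = v)) :
    val (t + 1) Φ v = ! val t Φ v := by
  have hne : ¬ (val (t + 1) Φ v = val t Φ v) := fun h => ((hvalW t Φ v).1 h) hfl
  clear hfl hvalW
  revert hne
  cases val (t + 1) Φ v <;> cases val t Φ v <;> simp

/-- **A variable that is not nominated keeps its value.** -/
theorem sissW_noflip_eq (val : ℕ → (Fin m → Fin k → Fin n × Bool) → Fin n → Bool)
    (hvalW : ∀ (t : ℕ) (Φ : (Fin m → Fin k → Fin n × Bool)) (v : Fin n), val (t + 1) Φ v = val t Φ v ↔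
      ¬ (∃ ii : Fin m, (∀ jj : Fin k, val t Φ (Φ ii jj).1 ≠ (Φ ii jj).2) ∧
        ∃ jf : Fin k, (∀ j' : Fin k, (if 1 ≤ t ∧ val t Φ (Φ ii jf).1 ≠ val (t - 1) Φ (Φ ii jf).1 then (2 : ℕ)
          else if (Φ ii jf).2 = true then 1 else 0) < (if 1 ≤ t ∧ val t Φ (Φ ii j').1 ≠ val (t - 1) Φ (Φ ii j').1 then (2 : ℕ)
          else if (Φ ii j').2 = true then 1 else 0) ∨
        ((if 1 ≤ t ∧ val t Φ (Φ ii jf).1 ≠ val (t - 1) Φ (Φ ii jf).1 then (2 : ℕ)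
          else if (Φ ii jf).2 = true then 1 else 0) = (if 1 ≤ t ∧ val t Φ (Φ ii j').1 ≠ val (t - 1) Φ (Φ ii j').1 then (2 : ℕ)
          else if (Φ ii j').2 = true then 1 else 0) ∧ jf ≤ j')) ∧ (Φ ii jf).1 = v))
    (t : ℕ) (Φ : (Fin m → Fin k → Fin n × Bool)) (v : Fin n) (hfl : ¬ (∃ ii : Fin m, (∀ jj : Fin k, val t Φ (Φ ii jj).1 ≠ (Φ ii jj).2) ∧
        ∃ jf : Fin k, (∀ j' : Fin k, (if 1 ≤ t ∧ val t Φ (Φ ii jf).1 ≠ val (t - 1) Φ (Φ ii jf).1 then (2 : ℕ)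
          else if (Φ ii jf).2 = true then 1 else 0) < (if 1 ≤ t ∧ val t Φ (Φ ii j').1 ≠ val (t - 1) Φ (Φ ii j').1 then (2 : ℕ)
          else if (Φ ii j').2 = true then 1 else 0) ∨
        ((if 1 ≤ t ∧ val t Φ (Φ ii jf).1 ≠ val (t - 1) Φ (Φ ii jf).1 then (2 : ℕ)
          else if (Φ ii jf).2 = true then 1 else 0) = (if 1 ≤ t ∧ val t Φ (Φ ii j').1 ≠ val (t - 1) Φ (Φ ii j').1 then (2 : ℕ)
          else if (Φ ii j').2 = true then 1 else 0) ∧ jf ≤ j')) ∧ (Φ ii jf).1 = v)) :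
    val (t + 1) Φ v = val t Φ v :=
  (hvalW t Φ v).2 hfl

/-- **A variable that changed was nominated**: `val (t+1) ≠ val t` implies a flip event at round `t`. -/
theorem sissW_rec_flip (val : ℕ → (Fin m → Fin k → Fin n × Bool) → Fin n → Bool)
    (hvalW : ∀ (t : ℕ) (Φ : (Fin m → Fin k → Fin n × Bool)) (v : Fin n), val (t + 1) Φ v = val t Φ v ↔
      ¬ (∃ ii : Fin m, (∀ jj : Fin k, val t Φ (Φ ii jj).1 ≠ (Φ ii jj).2) ∧
        ∃ jf : Fin k, (∀ j' : Fin k, (if 1 ≤ t ∧ val t Φ (Φ ii jf).1 ≠ val (t - 1) Φ (Φ ii jf).1 then (2 : ℕ)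
          else if (Φ ii jf).2 = true then 1 else 0) < (if 1 ≤ t ∧ val t Φ (Φ ii j').1 ≠ val (t - 1) Φ (Φ ii j').1 then (2 : ℕ)
          else if (Φ ii j').2 = true then 1 else 0) ∨
        ((if 1 ≤ t ∧ val t Φ (Φ ii jf).1 ≠ val (t - 1) Φ (Φ ii jf).1 then (2 : ℕ)
          else if (Φ ii jf).2 = true then 1 else 0) = (if 1 ≤ t ∧ val t Φ (Φ ii j').1 ≠ val (t - 1) Φ (Φ ii j').1 then (2 : ℕ)
          else if (Φ ii j').2 = true then 1 else 0) ∧ jf ≤ j')) ∧ (Φ ii jf).1 = v))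
    (t : ℕ) (Φ : (Fin m → Fin k → Fin n × Bool)) (v : Fin n) (hne : val (t + 1) Φ v ≠ val t Φ v) :
    (∃ ii : Fin m, (∀ jj : Fin k, val t Φ (Φ ii jj).1 ≠ (Φ ii jj).2) ∧
        ∃ jf : Fin k, (∀ j' : Fin k, (if 1 ≤ t ∧ val t Φ (Φ ii jf).1 ≠ val (t - 1) Φ (Φ ii jf).1 then (2 : ℕ)
          else if (Φ ii jf).2 = true then 1 else 0) < (if 1 ≤ t ∧ val t Φ (Φ ii j').1 ≠ val (t - 1) Φ (Φ ii j').1 then (2 : ℕ)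
          else if (Φ ii j').2 = true then 1 else 0) ∨
        ((if 1 ≤ t ∧ val t Φ (Φ ii jf).1 ≠ val (t - 1) Φ (Φ ii jf).1 then (2 : ℕ)
          else if (Φ ii jf).2 = true then 1 else 0) = (if 1 ≤ t ∧ val t Φ (Φ ii j').1 ≠ val (t - 1) Φ (Φ ii j').1 then (2 : ℕ)
          else if (Φ ii j').2 = true then 1 else 0) ∧ jf ≤ j')) ∧ (Φ ii jf).1 = v) := by
  by_contra hcon
  exact hne (sissW_noflip_eq val hvalW t Φ v hcon)

/-- **No dead clauses: a violated clause is satisfied at the next round** (`k ≥ 1`): its nominee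
flips and its literal becomes true. -/
theorem sissW_not_viol_succ (val : ℕ → (Fin m → Fin k → Fin n × Bool) → Fin n → Bool)
    (hvalW : ∀ (t : ℕ) (Φ : (Fin m → Fin k → Fin n × Bool)) (v : Fin n), val (t + 1) Φ v = val t Φ v ↔
      ¬ (∃ ii : Fin m, (∀ jj : Fin k, val t Φ (Φ ii jj).1 ≠ (Φ ii jj).2) ∧
        ∃ jf : Fin k, (∀ j' : Fin k, (if 1 ≤ t ∧ val t Φ (Φ ii jf).1 ≠ val (t - 1) Φ (Φ ii jf).1 then (2 : ℕ)
          else if (Φ ii jf).2 = true then 1 else 0) < (if 1 ≤ t ∧ val t Φ (Φ ii j').1 ≠ val (t - 1) Φ (Φ ii j').1 then (2 : ℕ)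
          else if (Φ ii j').2 = true then 1 else 0) ∨
        ((if 1 ≤ t ∧ val t Φ (Φ ii jf).1 ≠ val (t - 1) Φ (Φ ii jf).1 then (2 : ℕ)
          else if (Φ ii jf).2 = true then 1 else 0) = (if 1 ≤ t ∧ val t Φ (Φ ii j').1 ≠ val (t - 1) Φ (Φ ii j').1 then (2 : ℕ)
          else if (Φ ii j').2 = true then 1 else 0) ∧ jf ≤ j')) ∧ (Φ ii jf).1 = v))
    (hk : 1 ≤ k) (t : ℕ) (Φ : (Fin m → Fin k → Fin n × Bool)) (i : Fin m) (hviol : (∀ jj : Fin k, val t Φ (Φ i jj).1 ≠ (Φ i jj).2)) :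
    ¬ (∀ jj : Fin k, val (t + 1) Φ (Φ i jj).1 ≠ (Φ i jj).2) := by
  obtain ⟨j₀, hj₀⟩ := sissW_nom_exists val t Φ i hk
  have hfl : (∃ ii : Fin m, (∀ jj : Fin k, val t Φ (Φ ii jj).1 ≠ (Φ ii jj).2) ∧
        ∃ jf : Fin k, (∀ j' : Fin k, (if 1 ≤ t ∧ val t Φ (Φ ii jf).1 ≠ val (t - 1) Φ (Φ ii jf).1 then (2 : ℕ)
          else if (Φ ii jf).2 = true then 1 else 0) < (if 1 ≤ t ∧ val t Φ (Φ ii j').1 ≠ val (t - 1) Φ (Φ ii j').1 then (2 : ℕ)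
          else if (Φ ii j').2 = true then 1 else 0) ∨
        ((if 1 ≤ t ∧ val t Φ (Φ ii jf).1 ≠ val (t - 1) Φ (Φ ii jf).1 then (2 : ℕ)
          else if (Φ ii jf).2 = true then 1 else 0) = (if 1 ≤ t ∧ val t Φ (Φ ii j').1 ≠ val (t - 1) Φ (Φ ii j').1 then (2 : ℕ)
          else if (Φ ii j').2 = true then 1 else 0) ∧ jf ≤ j')) ∧ (Φ ii jf).1 = (Φ i j₀).1) := ⟨i, hviol, j₀, hj₀, rfl⟩
  have hnew := sissW_flip_ne val hvalW t Φ _ hfl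
  intro hv
  have h1 := hviol j₀
  have h2 := hv j₀
  rw [hnew] at h2
  clear hfl hnew hv hvalW hviol hj₀
  generalize val t Φ (Φ i j₀).1 = a at h1 h2
  generalize (Φ i j₀).2 = b at h1 h2
  revert h1 h2
  cases a <;> cases b <;> simp

/-- **Recency: a clause violated at round `t + 1` has a slot whose variable flipped at round `t`**
(it was satisfied at round `t`, by `sissW_not_viol_succ`). -/
theorem sissW_newly_violated (val : ℕ → (Fin m → Fin k → Fin n × Bool) → Fin n → Bool)
    (hvalW : ∀ (t : ℕ) (Φ : (Fin m → Fin k → Fin n × Bool)) (v : Fin n), val (t + 1) Φ v = val t Φ v ↔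
      ¬ (∃ ii : Fin m, (∀ jj : Fin k, val t Φ (Φ ii jj).1 ≠ (Φ ii jj).2) ∧
        ∃ jf : Fin k, (∀ j' : Fin k, (if 1 ≤ t ∧ val t Φ (Φ ii jf).1 ≠ val (t - 1) Φ (Φ ii jf).1 then (2 : ℕ)
          else if (Φ ii jf).2 = true then 1 else 0) < (if 1 ≤ t ∧ val t Φ (Φ ii j').1 ≠ val (t - 1) Φ (Φ ii j').1 then (2 : ℕ)
          else if (Φ ii j').2 = true then 1 else 0) ∨
        ((if 1 ≤ t ∧ val t Φ (Φ ii jf).1 ≠ val (t - 1) Φ (Φ ii jf).1 then (2 : ℕ)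
          else if (Φ ii jf).2 = true then 1 else 0) = (if 1 ≤ t ∧ val t Φ (Φ ii j').1 ≠ val (t - 1) Φ (Φ ii j').1 then (2 : ℕ)
          else if (Φ ii j').2 = true then 1 else 0) ∧ jf ≤ j')) ∧ (Φ ii jf).1 = v))
    (hk : 1 ≤ k) (t : ℕ) (Φ : (Fin m → Fin k → Fin n × Bool)) (i : Fin m) (hviol : (∀ jj : Fin k, val (t + 1) Φ (Φ i jj).1 ≠ (Φ i jj).2)) :
    ∃ j : Fin k, val (t + 1) Φ (Φ i j).1 ≠ val t Φ (Φ i j).1 := by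
  have hsat : ¬ (∀ jj : Fin k, val t Φ (Φ i jj).1 ≠ (Φ i jj).2) := fun h => sissW_not_viol_succ val hvalW hk t Φ i h hviol
  push Not at hsat
  obtain ⟨j, hj⟩ := hsat
  refine ⟨j, fun hcon => ?_⟩
  have := hviol j
  rw [hcon, hj] at this
  exact this rfl

/-- **A `false` variable was flipped from `true` to `false`**: if `val t Φ u = false` then at some
round `s < t` the variable `u` was `true`, nominated, and `false` at round `s + 1`. -/
theorem sissW_exists_flip_false (val : ℕ → (Fin m → Fin k → Fin n × Bool) → Fin n → Bool)
    (hval0 : ∀ (Φ : (Fin m → Fin k → Fin n × Bool)) (v : Fin n), val 0 Φ v = true)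
    (hvalW : ∀ (t : ℕ) (Φ : (Fin m → Fin k → Fin n × Bool)) (v : Fin n), val (t + 1) Φ v = val t Φ v ↔
      ¬ (∃ ii : Fin m, (∀ jj : Fin k, val t Φ (Φ ii jj).1 ≠ (Φ ii jj).2) ∧
        ∃ jf : Fin k, (∀ j' : Fin k, (if 1 ≤ t ∧ val t Φ (Φ ii jf).1 ≠ val (t - 1) Φ (Φ ii jf).1 then (2 : ℕ)
          else if (Φ ii jf).2 = true then 1 else 0) < (if 1 ≤ t ∧ val t Φ (Φ ii j').1 ≠ val (t - 1) Φ (Φ ii j').1 then (2 : ℕ)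
          else if (Φ ii j').2 = true then 1 else 0) ∨
        ((if 1 ≤ t ∧ val t Φ (Φ ii jf).1 ≠ val (t - 1) Φ (Φ ii jf).1 then (2 : ℕ)
          else if (Φ ii jf).2 = true then 1 else 0) = (if 1 ≤ t ∧ val t Φ (Φ ii j').1 ≠ val (t - 1) Φ (Φ ii j').1 then (2 : ℕ)
          else if (Φ ii j').2 = true then 1 else 0) ∧ jf ≤ j')) ∧ (Φ ii jf).1 = v))
    (Φ : (Fin m → Fin k → Fin n × Bool)) (u : Fin n) :
    ∀ t : ℕ, val t Φ u = false → ∃ s : ℕ, s < t ∧ ((∃ ii : Fin m, (∀ jj : Fin k, val s Φ (Φ ii jj).1 ≠ (Φ ii jj).2) ∧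
        ∃ jf : Fin k, (∀ j' : Fin k, (if 1 ≤ s ∧ val s Φ (Φ ii jf).1 ≠ val (s - 1) Φ (Φ ii jf).1 then (2 : ℕ)
          else if (Φ ii jf).2 = true then 1 else 0) < (if 1 ≤ s ∧ val s Φ (Φ ii j').1 ≠ val (s - 1) Φ (Φ ii j').1 then (2 : ℕ)
          else if (Φ ii j').2 = true then 1 else 0) ∨
        ((if 1 ≤ s ∧ val s Φ (Φ ii jf).1 ≠ val (s - 1) Φ (Φ ii jf).1 then (2 : ℕ)
          else if (Φ ii jf).2 = true then 1 else 0) = (if 1 ≤ s ∧ val s Φ (Φ ii j').1 ≠ val (s - 1) Φ (Φ ii j').1 then (2 : ℕ)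
          else if (Φ ii j').2 = true then 1 else 0) ∧ jf ≤ j')) ∧ (Φ ii jf).1 = u)) ∧
      val s Φ u = true ∧ val (s + 1) Φ u = false := by
  intro t
  induction t with
  | zero =>
    intro h
    rw [hval0] at h
    exact absurd h (by simp)
  | succ t ih =>
    intro h
    cases ht : val t Φ u
    · obtain ⟨s, hs, hfl, h1, h2⟩ := ih ht
      exact ⟨s, Nat.lt_succ_of_lt hs, hfl, h1, h2⟩
    · refine ⟨t, Nat.lt_succ_self t, ?_, ht, h⟩
      refine sissW_rec_flip val hvalW t Φ u ?_
      rw [h, ht]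
      exact Bool.false_ne_true

end Dynamics

end Summit.PneNP.PneNP.Theorems
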